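import Summits.AtomisticToContinuum.Crystallization.Theorems.ChartedPlanarOrderPlanesVirial

/-!
# Slot 7b by the method of planes, module P3h: the final virial-versus-stress inequality, explicit thresholds (decomp-a2c lens-3 g26; critic row 523 (b) (g2))

Blocker `N = ChartedPlanarOrder.ChartedZeroExcessLayered`, leaf 7b `GapStressVanishesW (17/16)`.  For a stacked layered `δ`-separated
configuration `Y = Layered a b w` (unit normal `ν ⊥ a, b`, heights in `[h_lo, h_hi]`, reduced layer shifts of length `≤ R'`) whose transmitted
stress is CONSTANT, `gapStress a b m (incr w) = σ` for all gaps `m`, and for EVERY range `R ≥ 2δ` (with `s₀` layers covering the range,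
`R < h_lo (s₀ + 1)`), EVERY cube `cube c ℓ` (`ℓ ≥ 0`) and every test vector `v` (`planes_final`):

  `∃ W ∈ [2 h_lo #F, 2 h_hi #F],  |𝒲(F)(ν, v) + ⟪v, σ⟫ W| ≤ ‖v‖ · E(ℓ, R)`,   `F = Y ∩ cube c ℓ`,
  `E(ℓ, R) = Λ(δ)((2ℓ/δ+1)³ (2δ/R) + 6 (2ℓ/δ+1)² (2R/δ+1)) + (C₂/R) 2 h_hi (2ℓ/δ+1)³ + 8 s₀³ h_hi Φmax · 6 (2ℓ/δ+1)² (2R'/δ+1)`,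

i.e. `E = O(ℓ³/R) + O_R(ℓ²)` with configuration-free constants in `(δ, h_lo, h_hi)`.  Assembly of: C1 `…PlanesColumn.abs_virialForm_sub_sum_colSum_le`
(far pairs + collar), D1 `…PlanesRearrangement.sum_colSum_eq_sum_layerCount_mul_col` (layerwise rearrangement), the planes estimate
`…PlanesVirial.abs_planes_le` + `Wt_bounds`, the collar bound on the total variation of the layer counts `…PlanesCollar.sum_abs_layerCount_sub_le`
(lens-4's `…EnergyThinProfiles.sum_abs_layerCount_sub_le` landed first; cross-reference in `…PlanesCollar`) and the counts `…PlanesCount.card_cube_le`,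
`…PlanesCollar.card_collar_le`.

Mathlib only (+ the lens-3 modules imported); `[folklore]`; no instances, no notation, sorry-free.
-/

noncomputable section

open Finset
open scoped RealInnerProductSpace
open Summit.AtomisticToContinuum.Crystallization.Theorems.ChartedPlanarOrderRigidityDoor
open Summit.AtomisticToContinuum.Crystallization.Theorems.ChartedPlanarOrderDensityDichotomy
open Summit.AtomisticToContinuum.Crystallization.Theorems.ChartedPlanarOrderMesoCut
open Summit.AtomisticToContinuum.Crystallization.Theorems.ChartedPlanarOrderProfileSlavingLJ (IsStacked gapStress incr)
open Summit.AtomisticToContinuum.Crystallization.Theorems.ChartedPlanarOrderDoorLayered (Layered)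
open Summit.AtomisticToContinuum.Crystallization.Theorems.ChartedPlanarOrderNashForceBalance
open Summit.AtomisticToContinuum.Crystallization.Theorems.ChartedPlanarOrderPlanesPairs (isStacked_of_heights)
open Summit.AtomisticToContinuum.Crystallization.Theorems.ChartedPlanarOrderPlanesVirialForm (virialForm)
open Summit.AtomisticToContinuum.Crystallization.Theorems.ChartedPlanarOrderPlanesCount (idx mem_idx layerCount card_eq_card_idx card_cube_le)
open Summit.AtomisticToContinuum.Crystallization.Theorems.ChartedPlanarOrderPlanesCollar (cube innerCollar sum_abs_layerCount_sub_le card_collar_le)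
open Summit.AtomisticToContinuum.Crystallization.Theorems.ChartedPlanarOrderPlanesColumn (colSum Lam Lam_nonneg abs_virialForm_sub_sum_colSum_le)
open Summit.AtomisticToContinuum.Crystallization.Theorems.ChartedPlanarOrderPlanesRearrangement (col sum_colSum_eq_sum_layerCount_mul_col)
open Summit.AtomisticToContinuum.Crystallization.Theorems.ChartedPlanarOrderPlanesVirial

namespace Summit.AtomisticToContinuum.Crystallization.Theorems.ChartedPlanarOrderPlanesEstimate

variable {δ : ℝ} {a b ν : E3} {w : ℤ → E3} {h_lo h_hi : ℝ}

/-- point counts with a predicate = index counts with the pulled-back predicate. -/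
theorem card_filter_eq (hinj : Function.Injective (layerPoint a b w)) (F : Finset E3) (hF : (↑F : Set E3) ⊆ Layered a b w)
    (P : E3 → Prop) [DecidablePred P] :
    (F.filter P).card = ((idx a b w hinj F).filter fun s => P (layerPoint a b w s)).card := by
  rw [card_eq_card_idx hinj (F.filter P) (fun x hx => hF (mem_filter.mp hx).1)]
  congr 1
  ext s
  simp only [mem_idx, mem_filter]

/-- the error budget `E(ℓ, R)` of the final inequality (configuration-free constants in `(δ, h_lo, h_hi)`; `R'` = the reduced-shift length,
`s₀` = the number of layers within range). -/
def Err (δ h_lo h_hi R R' ℓ : ℝ) (s₀ : ℕ) : ℝ :=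
  Lam δ * ((2 * ℓ / δ + 1) ^ 3 * (2 * δ / R) + 6 * ((2 * ℓ / δ + 1) ^ 2 * (2 * R / δ + 1))) +
    C2 δ h_lo h_hi / R * (2 * h_hi * (2 * ℓ / δ + 1) ^ 3) +
      8 * (s₀ : ℝ) ^ 3 * h_hi * PhiMax δ h_lo * (6 * ((2 * ℓ / δ + 1) ^ 2 * (2 * R' / δ + 1)))

open Classical in
/-- ★★★ THE FINAL VIRIAL-VERSUS-STRESS INEQUALITY (all ranges `R ≥ 2δ`, all cubes, explicit budget `Err`). -/
theorem planes_final (hδ : 0 < δ) (hS : IsSep δ (Layered a b w)) (hab : LinearIndependent ℝ ![a, b])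
    (hν : ‖ν‖ = 1) (hνa : ⟪ν, a⟫ = 0) (hνb : ⟪ν, b⟫ = 0) (hlo : 0 < h_lo) (hhi : 0 < h_hi)
    (hH : ∀ j : ℤ, h_lo ≤ ⟪ν, w (j + 1) - w j⟫ ∧ ⟪ν, w (j + 1) - w j⟫ ≤ h_hi)
    (e : OrthonormalBasis (Fin 3) ℝ E3) (he : e 0 = ν) {R : ℝ} (hR : 2 * δ ≤ R) {s₀ : ℕ} (hs₀ : R < h_lo * ((s₀ : ℝ) + 1))
    {R' : ℝ} (hR' : 0 ≤ R') (hshift : ∀ j : ℤ, ∃ p q : ℤ, ‖(w (j + 1) - w j) + (((p : ℝ) • a) + ((q : ℝ) • b))‖ ≤ R')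
    (σ : E3) (hσ : ∀ m : ℤ, gapStress a b m (incr w) = σ) {c : E3} {ℓ : ℝ} (hℓ : 0 ≤ ℓ)
    (F : Finset E3) (hF : (↑F : Set E3) = Layered a b w ∩ cube c ℓ) (v : E3) :
    ∃ W : ℝ, 2 * h_lo * (F.card : ℝ) ≤ W ∧ W ≤ 2 * h_hi * (F.card : ℝ) ∧
      |virialForm F ν v + ⟪v, σ⟫ * W| ≤ ‖v‖ * Err δ h_lo h_hi R R' ℓ s₀ := by
  have hRpos : 0 < R := by linarith
  have hst : IsStacked a b w := isStacked_of_heights hνa hνb hlo hH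
  have hinj : Function.Injective (layerPoint a b w) := layerPoint_injective hab hst
  have hFsub : (↑F : Set E3) ⊆ Layered a b w := by
    rw [hF]
    exact Set.inter_subset_left
  have hΦ := PhiMax_nonneg hδ hlo.le
  have hC := C2_nonneg hδ hlo.le hhi.le
  have hLam := Lam_nonneg hδ
  have hv := norm_nonneg v
  -- the window `[K₀, K₁]` with margin `M₀ = s₀ + 1`
  obtain ⟨kmax, hkmax⟩ := Finset.bddAbove ((idx a b w hinj F).image (fun s => s.1))
  obtain ⟨kmin, hkmin⟩ := Finset.bddBelow ((idx a b w hinj F).image (fun s => s.1))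
  have hΛ : ∀ s ∈ idx a b w hinj F, (kmin - ((s₀ + 1 : ℕ) : ℤ)) + ((s₀ + 1 : ℕ) : ℤ) ≤ s.1 ∧
      s.1 ≤ (kmax + ((s₀ + 1 : ℕ) : ℤ)) - ((s₀ + 1 : ℕ) : ℤ) := by
    intro s hs
    have hk : s.1 ∈ (↑((idx a b w hinj F).image (fun s => s.1)) : Set ℤ) := mem_coe.mpr (mem_image_of_mem _ hs)
    have h1 := hkmin hk
    have h2 := hkmax hk
    constructor <;> omega
  set K₀ : ℤ := kmin - ((s₀ + 1 : ℕ) : ℤ) with hK₀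
  set K₁ : ℤ := kmax + ((s₀ + 1 : ℕ) : ℤ) with hK₁
  have hM₀R : R ≤ h_lo * ((s₀ + 1 : ℕ) : ℝ) := by
    push_cast
    exact hs₀.le
  obtain ⟨hW1, hW2⟩ := Wt_bounds hH hinj F hFsub (show 1 ≤ s₀ + 1 by omega) hΛ
  refine ⟨_, hW1, hW2, ?_⟩
  -- the four inputs
  have hC1 := abs_virialForm_sub_sum_colSum_le hδ hS hF hR ν v
  rw [hν, one_mul, sum_colSum_eq_sum_layerCount_mul_col hδ hS hab hν hνa hνb hlo hH hs₀ v hinj hFsub] at hC1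
  have hP := abs_planes_le hδ hS hab hν hνa hνb hlo hhi hH e he hRpos hs₀ v hinj F (le_refl (s₀ + 1)) hM₀R hΛ σ hσ
  have hTV := sum_abs_layerCount_sub_le hinj F hF (Ico (K₀ - s₀) (K₁ + s₀)) hshift
  have hcardF : (F.card : ℝ) ≤ (2 * ℓ / δ + 1) ^ 3 := card_cube_le (Layered a b w) hδ hS c hℓ F hF
  have hcolR := card_collar_le hinj F (c := c) hδ hℓ hRpos.le hS (R := R)
  have hcolR' := card_collar_le hinj F (c := c) hδ hℓ hR' hS (R := R')
  have hpt : ((F.filter fun x => x ∈ innerCollar c ℓ R).card : ℝ) =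
      (((idx a b w hinj F).filter fun s => layerPoint a b w s ∈ innerCollar c ℓ R).card : ℝ) := by
    exact_mod_cast card_filter_eq hinj F hFsub (fun x => x ∈ innerCollar c ℓ R)
  rw [hpt] at hC1
  -- the three error terms
  have hE1 : ‖v‖ * Lam δ * ((F.card : ℝ) * (2 * δ / R) +
      (((idx a b w hinj F).filter fun s => layerPoint a b w s ∈ innerCollar c ℓ R).card : ℝ)) ≤
        ‖v‖ * (Lam δ * ((2 * ℓ / δ + 1) ^ 3 * (2 * δ / R) + 6 * ((2 * ℓ / δ + 1) ^ 2 * (2 * R / δ + 1)))) := by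
    rw [mul_assoc]
    refine mul_le_mul_of_nonneg_left (mul_le_mul_of_nonneg_left (add_le_add ?_ hcolR) hLam) hv
    exact mul_le_mul_of_nonneg_right hcardF (by positivity)
  have hE2 : C2 δ h_lo h_hi / R * ∑ m ∈ Ioc K₀ K₁, (⟪ν, w m⟫ - ⟪ν, w (m - 1)⟫) *
      ((layerCount hinj F (m - 1) : ℝ) + layerCount hinj F m) ≤ C2 δ h_lo h_hi / R * (2 * h_hi * (2 * ℓ / δ + 1) ^ 3) := by
    refine mul_le_mul_of_nonneg_left (hW2.trans ?_) (div_nonneg hC hRpos.le)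
    exact mul_le_mul_of_nonneg_left hcardF (by positivity)
  have hE3 : 4 * (s₀ : ℝ) ^ 3 * h_hi * PhiMax δ h_lo *
      ∑ j ∈ Ico (K₀ - s₀) (K₁ + s₀), |(layerCount hinj F (j + 1) : ℝ) - layerCount hinj F j| ≤
        8 * (s₀ : ℝ) ^ 3 * h_hi * PhiMax δ h_lo * (6 * ((2 * ℓ / δ + 1) ^ 2 * (2 * R' / δ + 1))) := by
    have h1 := hTV.trans (mul_le_mul_of_nonneg_left hcolR' (by norm_num : (0 : ℝ) ≤ 2))
    have h2 := mul_le_mul_of_nonneg_left h1 (show 0 ≤ 4 * (s₀ : ℝ) ^ 3 * h_hi * PhiMax δ h_lo by positivity)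
    exact h2.trans (le_of_eq (by ring))
  -- assemble
  have hsplit : virialForm F ν v + ⟪v, σ⟫ * ∑ m ∈ Ioc K₀ K₁, (⟪ν, w m⟫ - ⟪ν, w (m - 1)⟫) *
      ((layerCount hinj F (m - 1) : ℝ) + layerCount hinj F m) =
        (virialForm F ν v - ∑ k ∈ (idx a b w hinj F).image (fun s => s.1), (layerCount hinj F k : ℝ) * col a b w ν v R s₀ k) +
          (∑ k ∈ (idx a b w hinj F).image (fun s => s.1), (layerCount hinj F k : ℝ) * col a b w ν v R s₀ k +
            ⟪v, σ⟫ * ∑ m ∈ Ioc K₀ K₁, (⟪ν, w m⟫ - ⟪ν, w (m - 1)⟫) * ((layerCount hinj F (m - 1) : ℝ) + layerCount hinj F m)) := by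
    ring
  rw [hsplit]
  refine (abs_add_le _ _).trans ?_
  have h4 := mul_le_mul_of_nonneg_left (add_le_add hE2 hE3) hv
  unfold Err
  linarith [hC1, hP, hE1, h4]

end Summit.AtomisticToContinuum.Crystallization.Theorems.ChartedPlanarOrderPlanesEstimate
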